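import Mathlib
import Summits.Ventures.PercRepro2.M9WeightedHarris
import Summits.Ventures.PercRepro2.M9SplitWeight

/-!
# CLASS C4 of the single-`d` statement — the assembly (blind cell PercRepro2, p3 g28,
2026-08-28; `proofs/P3-PENDANT.md` §2)

The abstract shape of the pendant-pocket-region class.  A state is a triple
`(x, e, o)`: the block sides `x ⊆ ι`, the colouring `e` of the edges at the region of `d`
(type `D`) and the colouring `o` of the other edges (type `O`).  Legality depends on `(e, x)`
only, and on `x` only through the status of `d`: `LK e` when `S ⊆ x` (`d` in the `Y`-world
only), `LM e` when `Disjoint S x` (`d` in the `W`-world only), `LG e` when the `S`-blocks are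
split (`d` doubly reached); `σ_rs = f x` is monotone and odd, `σ_pq = g o x` is antitone in
`x` with an odd outside sum.  With `#LK = #LM ≥ #LG` the legal sum of `σ_pq σ_rs` is
non-positive (`pendant_sum_nonpos`): the legality count is the split weight of
`M9SplitWeight` and the sum is the weighted Harris of `M9WeightedHarris`.  The lemmas (i)–(iii)
of `P3-PENDANT.md` §2 instantiate `LK`, `LM`, `LG` for a pocket representative.  No
definitions.  Own work; std axioms.
-/

namespace Summit.Ventures.PercRepro2

namespace M9Reduce

open Finset

variable {ι : Type*} [Fintype ι] [DecidableEq ι]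

omit [Fintype ι] in
/-- The legality indicator of the pendant class: a function of the status of `d`. -/
lemma pendant_indicator_sum {D : Type*} [Fintype D] (S x : Finset ι)
    (LK LM LG : D → Prop) [DecidablePred LK] [DecidablePred LM] [DecidablePred LG]
    (hKM : (univ.filter LM).card = (univ.filter LK).card) :
    (∑ e : D, (if S ⊆ x then (if LK e then (1 : ℤ) else 0)
      else if Disjoint S x then (if LM e then 1 else 0) else (if LG e then 1 else 0))) =
      (if S ⊆ x ∨ Disjoint S x then ((univ.filter LK).card : ℤ)
        else ((univ.filter LG).card : ℤ)) := by
  by_cases h1 : S ⊆ x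
  · simp only [if_pos h1, if_pos (Or.inl h1)]
    rw [Finset.sum_boole]
  · by_cases h2 : Disjoint S x
    · simp only [if_neg h1, if_pos h2, if_pos (Or.inr h2)]
      rw [Finset.sum_boole, ← hKM]
    · have h3 : ¬ (S ⊆ x ∨ Disjoint S x) := fun h => h.elim h1 h2
      simp only [if_neg h1, if_neg h2, if_neg h3]
      rw [Finset.sum_boole]

/-- **CLASS C4, the assembly.** -/
theorem pendant_sum_nonpos {D O : Type*} [Fintype D] [Fintype O] (S : Finset ι)
    (LK LM LG : D → Prop) [DecidablePred LK] [DecidablePred LM] [DecidablePred LG]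
    (hKM : (univ.filter LM).card = (univ.filter LK).card)
    (hGK : (univ.filter LG).card ≤ (univ.filter LK).card)
    {f : Finset ι → ℤ} (hf : Monotone f) (hfκ : ∀ x, f xᶜ = -f x)
    {g : O → Finset ι → ℤ} (hg : ∀ o, Antitone (g o)) :
    ∑ x : Finset ι, ∑ e : D, ∑ o : O,
      (if S ⊆ x then (if LK e then (1 : ℤ) else 0)
        else if Disjoint S x then (if LM e then 1 else 0) else (if LG e then 1 else 0)) *
        (f x * g o x) ≤ 0 := by
  classical
  -- the weight and the outside sum
  let μ : Finset ι → ℤ := fun x =>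
    if S ⊆ x ∨ Disjoint S x then ((univ.filter LK).card : ℤ) else ((univ.filter LG).card : ℤ)
  let G : Finset ι → ℤ := fun x => ∑ o : O, g o x
  have hsum : ∀ x : Finset ι, (∑ e : D, ∑ o : O,
      (if S ⊆ x then (if LK e then (1 : ℤ) else 0)
        else if Disjoint S x then (if LM e then 1 else 0) else (if LG e then 1 else 0)) *
        (f x * g o x)) = μ x * (f x * G x) := by
    intro x
    have : ∀ e : D, (∑ o : O,
        (if S ⊆ x then (if LK e then (1 : ℤ) else 0)
          else if Disjoint S x then (if LM e then 1 else 0) else (if LG e then 1 else 0)) *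
          (f x * g o x)) =
        (if S ⊆ x then (if LK e then (1 : ℤ) else 0)
          else if Disjoint S x then (if LM e then 1 else 0) else (if LG e then 1 else 0)) *
          (f x * G x) := by
      intro e
      simp only [G, Finset.mul_sum]
    simp_rw [this]
    rw [← Finset.sum_mul, pendant_indicator_sum S x LK LM LG hKM]
  simp_rw [hsum]
  -- the hypotheses of the weighted Harris inequality
  have hμ₀ : 0 ≤ μ := fun x => by
    simp only [μ, Pi.zero_apply]; split_ifs <;> positivity
  have hμ : ∀ a b, μ a * μ b ≤ μ (a ⊓ b) * μ (a ⊔ b) := fun a b =>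
    splitWeight_mul_le S (a := ((univ.filter LK).card : ℤ)) (b := ((univ.filter LG).card : ℤ))
      (by positivity) (by exact_mod_cast hGK) a b
  have hμκ : ∀ x, μ xᶜ = μ x := fun x => splitWeight_compl S _ _ x
  have hG : Antitone G := fun x y hxy => Finset.sum_le_sum fun o _ => hg o hxy
  exact sum_weight_mul_nonpos (κ := fun x => xᶜ) (fun x => compl_compl x) hμ₀ hμ hμκ hf hfκ hG

end M9Reduce

end Summit.Ventures.PercRepro2
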